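import Summits.QuantumFields.YangMills.Theorems.BalabanLadderIRColdPurityBridge

/-!
# Route `BalabanLadder`, crux `IR` (stmt-QuantumFields-19354): the COLD-PURITY BRIDGE — §5 strong-coupling RUNGS

Second of the three files into which ideator ym-ir-idea-6's sorry-free helper module (rev 3b, 2026-08-28, evidence on
19354) is split at landing (lead prover ym-ir-line-bsf-p1 g2; gate limit 400 lines per Theorems file).  Text and
declarations of the ideator's §5 unchanged; §§1–4 are `BalabanLadderIRColdPurityBridge.lean`, §6 is
`BalabanLadderIRColdPurityBridgeSpectral.lean`.  `--supports stmt-QuantumFields-19354`; no registered stub is claimed.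

HONEST FRAMING.  The Yang–Mills mass gap (Clay) is NOT proved by anything here; R4 (`BalabanUVStability4`) closes only the
conditional finite-𝕋⁴ rung `BalabanLadder.UV`.  The rungs below live on the strong-coupling window `0 ≤ β ≤ r_ρ` and are
group-blind; they carry no weak-coupling content.
-/

set_option autoImplicit false

noncomputable section

open Filter Topology MeasureTheory
open scoped SchwartzMap
open Literature.MathematicalPhysics.QuantumFieldTheory Literature.MathematicalPhysics.QuantumLattice
open Summit.QuantumFields.YangMills.Cruxes.OSLegsFromFemtoAndGap.DlrCollarTransfer (GapInUnits LowerBounds Q2)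
open Literature.MathematicalPhysics.QuantumFieldTheory.Balaban1983to89.Sufficient (ColdPressureBound)
open Summit.QuantumFields.YangMills.Theorems.DoublingDefect (coldDefect_nonneg traceExcess_le_of_coldDefect_le
  traceExcess_le_exp_of_le defect_decay_of_recursion)
open Summit.QuantumFields.YangMills.Cruxes.IR.ColdPressurePincer

namespace Summit.QuantumFields.YangMills.Cruxes.IR.ColdPurityBridge

/-! ## §5 Rungs on the strong-coupling window `0 ≤ β ≤ r_ρ` (critic ym-ir-crit-1, price (d) «rung not typed»)

Group-blind (every compact `G`, every lattice representation): the strong-coupling cluster expansion of the tree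
(`Balaban1983to89.Missing.traceExcess_le_of_strongCoupling`, PROVED: `x_{T+2}(N) ≤ exp(12N³(T+2)e^{−⌊(T+2)/2⌋}) − 1` for
`0 ≤ β ≤ strongCouplingRadius ρ`) bounds the thermal trace excess, and `δᶜ ≤ 2x` (below) turns it into purity.  So:
E's body holds on the window (PROVED, `coldExitSC_strongCoupling`, even uniformly in `β`); H's CONCLUSION holds there
WITHOUT its floor hypothesis (PROVED, `floorToPurity_conclusion_strongCoupling` — honest reading: H is conclusion-free at
strong coupling, all of its content sits at weak coupling); R's instance on the window is TYPED and left OPEN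
(`ColdDoublingRecursionStrongCoupling`): its upper half is the same tree bound, the matching LOWER bound
`δᶜ_β(L) ≳ L³e^{−m(β)L/4}` (one-particle dominance of the thermal trace) is not in tree. -/

section Rungs

variable {G : Type} [Group G] [TopologicalSpace G] [IsTopologicalGroup G] [CompactSpace G]
  [MeasurableSpace G] [BorelSpace G]

open Literature.MathematicalPhysics.QuantumFieldTheory.Balaban1983to89.Missing (strongCouplingRadius
  traceExcess_le_of_strongCoupling)
open Summit.QuantumFields.YangMills.Theorems.DoublingDefect (exists_ratios_hasSum_traceExcess)

/-- **Impurity is carried by the trace excess**: `1 − Z(N³×2t)/Z(N³×t)² ≤ 2·x_t(N)` for `t = m + 2`, `β ≥ 0`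
(`Z(2t)/Z(t)² = T₂/T₁²` with `T₁ = 1 + x_t`, `T₂ = 1 + x_{2t} ≥ 1`, and `1 − 1/(1+x)² ≤ 2x`) — the converse bookkeeping
to `DoublingDefect.traceExcess_le_of_coldDefect_le`. -/
theorem one_sub_ratio_le_two_mul_traceExcess (r : LatticeRep G) {β : ℝ} (hβ : 0 ≤ β) (N m : ℕ) [NeZero N] :
    1 - wilsonFinTorusPartition r.ρ β N N N (2 * (m + 2)) / wilsonFinTorusPartition r.ρ β N N N (m + 2) ^ 2 ≤
      2 * traceExcess r.ρ β N (m + 2) := by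
  haveI : SecondCountableTopology G :=
    (r.continuous.isClosedEmbedding r.injective).isEmbedding.secondCountableTopology
  obtain ⟨ι, _, q, i₀, hq, hqi₀, hpos, hT, hx⟩ :=
    exists_ratios_hasSum_traceExcess r.continuous r.mem_unitary hβ N
  set lp : ℝ := transferSpectralRadius r.ρ β N with hlp
  set W₁ : ℝ := wilsonFinTorusPartition r.ρ β N N N (m + 2) with hW₁
  set W₂ : ℝ := wilsonFinTorusPartition r.ρ β N N N (2 * (m + 2)) with hW₂
  have hW₁pos : 0 < W₁ := wilsonFinTorusPartition_pos r.continuous β N N N (m + 2)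
  have hT₁ := hT m
  have hT₂ : HasSum (fun i => q i ^ (2 * m + 2 + 2)) (W₂ / lp ^ (2 * (m + 2))) := by
    have h := hT (2 * m + 2)
    rw [show 2 * m + 2 + 2 = 2 * (m + 2) from by ring] at h ⊢
    exact h
  set T₁ : ℝ := W₁ / lp ^ (m + 2) with hT₁def
  set T₂ : ℝ := W₂ / lp ^ (2 * (m + 2)) with hT₂def
  have hT₂ge : 1 ≤ T₂ := by
    have h := le_hasSum hT₂ i₀ fun j _ => pow_nonneg (hq j).1 _
    simpa [hqi₀] using h
  have hT₁ge : 1 ≤ T₁ := by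
    have h := le_hasSum hT₁ i₀ fun j _ => pow_nonneg (hq j).1 _
    simpa [hqi₀] using h
  have hxT : traceExcess r.ρ β N (m + 2) = T₁ - 1 := by
    have h := hx m
    have h' : HasSum (Function.update (fun i => q i ^ (m + 2)) i₀ 0) (0 - 1 + T₁) := by
      have := hT₁.update i₀ 0
      simpa [hqi₀] using this
    have := h.unique h'
    linarith
  have hT₁pos : 0 < T₁ := lt_of_lt_of_le one_pos hT₁ge
  have hid : W₂ / W₁ ^ 2 = T₂ / T₁ ^ 2 := by
    have h1 : lp ^ (m + 2) ≠ 0 := pow_ne_zero _ hpos.ne'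
    have h2 : W₁ ≠ 0 := hW₁pos.ne'
    rw [hT₂def, hT₁def]
    field_simp
    ring
  have h1 : 1 / T₁ ^ 2 ≤ W₂ / W₁ ^ 2 := by
    rw [hid]
    exact div_le_div_of_nonneg_right hT₂ge (sq_nonneg _)
  have h2 : 1 - 2 * (T₁ - 1) ≤ 1 / T₁ ^ 2 := by
    rw [le_div_iff₀ (by positivity)]
    have hu : 0 ≤ T₁ - 1 := sub_nonneg.2 hT₁ge
    nlinarith [mul_nonneg hu hu, mul_nonneg (mul_nonneg hu hu) hu]
  rw [hxT]
  linarith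

/-- **Cold defect on the strong-coupling window**, tori `L = 8k`, `k ≥ 1`: `δᶜ_β(8k) ≤ 2(exp(12288·k⁴·e^{−k}) − 1)` for
`0 ≤ β ≤ strongCouplingRadius ρ` — `traceExcess_le_of_strongCoupling` at `N = 8k`, `T + 2 = 2k = ⌊8k/4⌋`, `⌊2k/2⌋ = k`. -/
theorem coldDefect_le_of_strongCoupling (r : LatticeRep G) {β : ℝ} (hβ0 : 0 ≤ β)
    (hβ : β ≤ strongCouplingRadius r.ρ) (k : ℕ) (hk : 1 ≤ k) :
    coldDefect r.ρ β (8 * k) ≤ 2 * (Real.exp (12288 * (k : ℝ) ^ 4 * Real.exp (-(k : ℝ))) - 1) := by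
  haveI : SecondCountableTopology G :=
    (r.continuous.isClosedEmbedding r.injective).isEmbedding.secondCountableTopology
  haveI : NeZero (8 * k) := ⟨by omega⟩
  obtain ⟨m, hm⟩ : ∃ m : ℕ, 2 * k = m + 2 := ⟨2 * k - 2, by omega⟩
  have hdiv : 8 * k / 4 = m + 2 := by omega
  have hfl : (m + 2) / 2 = k := by omega
  have hA := one_sub_ratio_le_two_mul_traceExcess r hβ0 (8 * k) m
  have hX := traceExcess_le_of_strongCoupling r.ρ r.continuous r.mem_unitary hβ0 hβ (8 * k) m
  rw [hfl] at hX
  have hcast : 12 * ((8 * k : ℕ) : ℝ) ^ 3 * ((m : ℝ) + 2) = 12288 * (k : ℝ) ^ 4 := by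
    have h2 : (m : ℝ) + 2 = 2 * k := by
      have := congrArg (Nat.cast : ℕ → ℝ) hm
      push_cast at this
      linarith
    rw [h2]
    push_cast
    ring
  rw [hcast] at hX
  unfold coldDefect
  rw [hdiv]
  linarith

/-- The strong-coupling majorant tends to zero: `2(exp(12288 k⁴ e^{−k}) − 1) → 0`. -/
theorem tendsto_strongCouplingMajorant :
    Tendsto (fun k : ℕ => 2 * (Real.exp (12288 * (k : ℝ) ^ 4 * Real.exp (-(k : ℝ))) - 1)) atTop (𝓝 0) := by
  have h1 : Tendsto (fun x : ℝ => x ^ 4 * Real.exp (-x)) atTop (𝓝 0) :=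
    Real.tendsto_pow_mul_exp_neg_atTop_nhds_zero 4
  have h2 : Tendsto (fun k : ℕ => 12288 * ((k : ℝ) ^ 4 * Real.exp (-(k : ℝ)))) atTop (𝓝 (12288 * 0)) :=
    (h1.comp tendsto_natCast_atTop_atTop).const_mul 12288
  have h3 : Tendsto (fun k : ℕ => 2 * (Real.exp (12288 * ((k : ℝ) ^ 4 * Real.exp (-(k : ℝ)))) - 1)) atTop
      (𝓝 (2 * (Real.exp (12288 * 0) - 1))) :=
    (((Real.continuous_exp.tendsto _).comp h2).sub_const 1).const_mul 2
  simp only [mul_zero, Real.exp_zero, sub_self] at h3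
  refine Tendsto.congr (fun k => ?_) h3
  simp only [mul_assoc]

/-- **Uniform cold exit on the strong-coupling window (PROVED)**: for every `ε > 0` one `k₁ ≥ 1` with `δᶜ_β(8k) ≤ ε`
for all `k ≥ k₁` and ALL `0 ≤ β ≤ strongCouplingRadius ρ`. -/
theorem coldExit_uniform_of_strongCoupling (r : LatticeRep G) {ε : ℝ} (hε : 0 < ε) :
    ∃ k₁ : ℕ, 1 ≤ k₁ ∧ ∀ β : ℝ, 0 ≤ β → β ≤ strongCouplingRadius r.ρ →
      ∀ k : ℕ, k₁ ≤ k → coldDefect r.ρ β (8 * k) ≤ ε := by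
  obtain ⟨k₀, hk₀⟩ := eventually_atTop.1 ((tendsto_order.1 tendsto_strongCouplingMajorant).2 ε hε)
  refine ⟨max k₀ 1, le_max_right _ _, fun β hβ0 hβ k hk => ?_⟩
  have h1 := coldDefect_le_of_strongCoupling r hβ0 hβ k (le_trans (le_max_right _ _) hk)
  have h2 := hk₀ k (le_trans (le_max_left _ _) hk)
  linarith [h1, h2.le]

/-- **RUNG for E (PROVED): the body of `ColdExitSC` on the strong-coupling window** — for every compact `G` and every
lattice representation (no simplicity, no `π₁ = 1`: strong coupling is group-blind), `0 ≤ β ≤ strongCouplingRadius r.ρ`,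
`ε > 0`, `L₀`: some `L ≥ L₀` has `δᶜ_β(L) ≤ ε`.  E itself asks this for all LARGE `β` on simply-connected simple `G`. -/
theorem coldExitSC_strongCoupling (r : LatticeRep G) {β : ℝ} (hβ0 : 0 ≤ β) (hβ : β ≤ strongCouplingRadius r.ρ)
    {ε : ℝ} (hε : 0 < ε) (L₀ : ℕ) : ∃ L : ℕ, L₀ ≤ L ∧ coldDefect r.ρ β L ≤ ε := by
  obtain ⟨k₁, hk₁, h⟩ := coldExit_uniform_of_strongCoupling r hε
  exact ⟨8 * max k₁ L₀, by omega, h β hβ0 hβ _ (le_max_left _ _)⟩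

/-- **RUNG for H (PROVED — and honestly CONCLUSION-ONLY): on the strong-coupling window the conclusion of
`FloorToPuritySC` holds WITHOUT the floor hypothesis**, with `s₀ = 1` and window factor `k = 16k₁(ε₀)`: for
`0 ≤ β ≤ strongCouplingRadius r.ρ` and `0 < s ≤ 1` some `L' ∈ [1/s, k/s]`, `L' ≥ 8`, is `ε₀`-pure.  (So H has NO content
at strong coupling; its content — the handshake between the floor scale and the purity scale — is at weak coupling.) -/
theorem floorToPurity_conclusion_strongCoupling (r : LatticeRep G) {ε₀ : ℝ} (hε₀ : 0 < ε₀) :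
    ∃ k : ℝ, ∀ β : ℝ, 0 ≤ β → β ≤ strongCouplingRadius r.ρ → ∀ s : ℝ, 0 < s → s ≤ 1 →
      ∃ L' : ℕ, 8 ≤ L' ∧ 1 / s ≤ (L' : ℝ) ∧ (L' : ℝ) ≤ k / s ∧ coldDefect r.ρ β L' ≤ ε₀ := by
  obtain ⟨k₁, hk₁, h⟩ := coldExit_uniform_of_strongCoupling r hε₀
  refine ⟨16 * k₁, fun β hβ0 hβ s hs hs1 => ?_⟩
  set j : ℕ := ⌈1 / s⌉₊ with hj
  have hj1 : 1 / s ≤ (j : ℝ) := Nat.le_ceil _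
  have hs' : 1 ≤ 1 / s := by rw [le_div_iff₀ hs]; linarith
  have hjpos : 1 ≤ j := by
    have : (1 : ℝ) ≤ j := hs'.trans hj1
    exact_mod_cast this
  have hjle : (j : ℝ) ≤ 1 / s + 1 := (Nat.ceil_lt_add_one (by positivity)).le
  have hkj : 1 ≤ k₁ * j := by simpa using Nat.mul_le_mul hk₁ hjpos
  have hk₁' : (1 : ℝ) ≤ k₁ := by exact_mod_cast hk₁
  have hj0 : (0 : ℝ) ≤ j := by positivity
  have hjs : (j : ℝ) * s ≤ 2 := by
    have h1 : (j : ℝ) * s ≤ (1 / s + 1) * s := mul_le_mul_of_nonneg_right hjle hs.le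
    have h2 : (1 / s + 1) * s = 1 + s := by field_simp
    rw [h2] at h1
    linarith
  refine ⟨8 * (k₁ * j), by omega, ?_, ?_, h β hβ0 hβ (k₁ * j) (Nat.le_mul_of_pos_right k₁ (by omega))⟩
  · push_cast
    nlinarith [mul_nonneg (sub_nonneg.2 hk₁') hj0]
  · rw [le_div_iff₀ hs]
    push_cast
    have h3 : 8 * ((k₁ : ℝ) * j) * s = 8 * k₁ * (j * s) := by ring
    rw [h3]
    have h4 : (0 : ℝ) ≤ 8 * k₁ := by positivity
    nlinarith [mul_le_mul_of_nonneg_left hjs h4]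

/-- **RUNG for R (TYPED, OPEN — not a stub of this line's composition): the dyadic contraction on the strong-coupling
window**, uniformly in `0 ≤ β ≤ strongCouplingRadius r.ρ` (group-blind).  Upper half in tree (`coldDefect_le_of_strongCoupling`);
the matching LOWER bound `δᶜ_β(L) ≥ c·L³·e^{−m(β)⌊L/4⌋}` (one-particle dominance of the thermal trace at strong coupling,
Osterwalder–Seiler 1978 §3 / Seiler LNP 159) is NOT in tree, so this rung is recorded, not proved. -/
def ColdDoublingRecursionStrongCoupling : Prop :=
  ∀ (G : Type) [Group G] [TopologicalSpace G] [IsTopologicalGroup G] [CompactSpace G],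
    letI : MeasurableSpace G := borel G
    haveI : BorelSpace G := ⟨rfl⟩
    ∀ r : LatticeRep G, ∃ C : ℝ, 0 < C ∧ ∃ L₀ : ℕ, ∀ β : ℝ, 0 ≤ β → β ≤ strongCouplingRadius r.ρ →
      ∀ L : ℕ, L₀ ≤ L → ∀ L' : ℕ, 2 * L ≤ L' → L' ≤ 4 * L →
        coldDefect r.ρ β L' ≤ C * coldDefect r.ρ β L ^ 2

end Rungs

end Summit.QuantumFields.YangMills.Cruxes.IR.ColdPurityBridge

end
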